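import Literature.Analysis.Complex.PQExtDeriv
import Literature.Analysis.Complex.PQTypesPullbackProofs
import Literature.Analysis.Complex.SeveralVariables
import Literature.NumberTheory.Transcendental.FormIntegrationCharts
import Mathlib.Analysis.Calculus.DifferentialForm.Basic
import Mathlib.Analysis.Calculus.FDeriv.RestrictScalars
import HarnessLib

/-!
# Pull-back of flat `(p,q)`-data along holomorphic maps

For the flat `∂̄`-calculus of `Literature/Analysis/Complex/PQTypes.lean`,
`Literature/Analysis/Complex/PQExtDeriv.lean` (forms `α : E → Λ^k E = E [⋀^Fin k]→L[ℝ] ℂ`,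
pointwise types `IsOfTypeAt`, the projection `typeProjAt`, Mathlib's `extDeriv`) this file
records how the data transform under the pull-back

  `flatPullback Φ α x = (α (Φ x)).compContinuousLinearMap (fderiv ℝ Φ x)`

along a map `Φ : E' → E`:

* precomposition with a **complex-linear** map preserves pointwise types and commutes with the
  type projection (`IsOfTypeAt.compContinuousLinearMap`, `typeProjAt_compContinuousLinearMap` of
  `Literature/Analysis/Complex/PQTypesPullbackProofs.lean`);
* `flatPullback` of a `C^∞` form along a `C^∞` map is `C^∞` (`ContDiffOn.flatPullback`), and
  `d` commutes with it (`extDeriv_flatPullback`, Mathlib's `extDeriv_pullback`);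
* along a **holomorphic** map the real derivative is complex-linear, so types and type projections
  are preserved (`typeProjAt_flatPullback`) and `(d Φ^*α)^{p,q} = Φ^*((dα)^{p,q})`
  (`typeProjAt_extDeriv_flatPullback`) — the flat form of "`∂̄` commutes with holomorphic
  pull-backs" (Hörmander (1973), §2.1, p. 24; Voisin (2002), §2.3.1);
* functoriality (`flatPullback_flatPullback`, `flatPullback_id`) and compatibility with scalar
  factors;
* the product rule with a **holomorphic scalar factor**: `(d(φ α))^{p,q+1} = φ (dα)^{p,q+1}` for
  `α` of type `(p,q)` on `ℂ^ι` (`typeProjAt_extDeriv_smul_of_differentiableAt`), i.e.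
  `∂̄(φ α) = φ ∂̄α`.

These are the transport lemmas used in Oka's embedding argument (Hörmander (1973), Lemma 2.7.5).

## References

* L. Hörmander, *An Introduction to Complex Analysis in Several Variables*, 2nd ed. (1973),
  §2.1, Lemma 2.7.5. [HormanderSCV1973]
* C. Voisin, *Hodge Theory and Complex Algebraic Geometry I* (2002), §2.3.1. [Voisin2002]
-/

noncomputable section

open scoped ContDiff Topology
open Complex Function Set Filter ContinuousAlternatingMap
open Literature.LinearAlgebra.Alternating Literature.NumberTheory.Transcendental

namespace Literature.Analysis.Complex

variable {E : Type*} [NormedAddCommGroup E] [NormedSpace ℂ E]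
  {E' : Type*} [NormedAddCommGroup E'] [NormedSpace ℂ E']
  {E'' : Type*} [NormedAddCommGroup E''] [NormedSpace ℂ E'']
  {F : Type*} [NormedAddCommGroup F] [NormedSpace ℝ F] {k : ℕ}

/-! ### Algebra of `compContinuousLinearMap` -/

omit [NormedSpace ℂ E] [NormedSpace ℂ E'] in
/-- Precomposition is compatible with complex scalars. [folklore] -/
theorem smul_compContinuousLinearMap_complex [NormedSpace ℝ E] [NormedSpace ℝ E'] (c : ℂ)
    (η : E [⋀^Fin k]→L[ℝ] ℂ) (L : E' →L[ℝ] E) :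
    (c • η).compContinuousLinearMap L = c • η.compContinuousLinearMap L := by
  ext v; rfl

omit [NormedSpace ℂ E] [NormedSpace ℂ E'] in
/-- Precomposition of a finite sum. [folklore] -/
theorem sum_compContinuousLinearMap [NormedSpace ℝ E] [NormedSpace ℝ E'] {β : Type*} (s : Finset β)
    (η : β → E [⋀^Fin k]→L[ℝ] F) (L : E' →L[ℝ] E) :
    (∑ b ∈ s, η b).compContinuousLinearMap L = ∑ b ∈ s, (η b).compContinuousLinearMap L := by
  have := map_sum (ContinuousAlternatingMap.compContinuousLinearMapCLM (ι := Fin k) (F := F) L :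
    (E [⋀^Fin k]→L[ℝ] F) →L[ℝ] (E' [⋀^Fin k]→L[ℝ] F)) η s
  simpa only [ContinuousAlternatingMap.compContinuousLinearMapCLM_apply] using this

omit [NormedSpace ℂ E] [NormedSpace ℂ E'] in
/-- Precomposition of a difference. [folklore] -/
theorem sub_compContinuousLinearMap [NormedSpace ℝ E] [NormedSpace ℝ E'] (η η' : E [⋀^Fin k]→L[ℝ] F)
    (L : E' →L[ℝ] E) :
    (η - η').compContinuousLinearMap L = η.compContinuousLinearMap L - η'.compContinuousLinearMap L := by
  ext v; rfl

omit [NormedSpace ℂ E] [NormedSpace ℂ E'] in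
/-- Precomposition of a real-scalar multiple (any module scalar acting compatibly). [folklore] -/
theorem smul_compContinuousLinearMap_real [NormedSpace ℝ E] [NormedSpace ℝ E'] (c : ℝ)
    (η : E [⋀^Fin k]→L[ℝ] F) (L : E' →L[ℝ] E) :
    (c • η).compContinuousLinearMap L = c • η.compContinuousLinearMap L := by
  ext v; rfl

omit [NormedSpace ℂ E] [NormedSpace ℂ E'] [NormedSpace ℂ E''] in
/-- Associativity of precomposition. [folklore] -/
theorem compContinuousLinearMap_compContinuousLinearMap [NormedSpace ℝ E] [NormedSpace ℝ E']
    [NormedSpace ℝ E''] (η : E [⋀^Fin k]→L[ℝ] F) (L : E' →L[ℝ] E) (L' : E'' →L[ℝ] E') :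
    (η.compContinuousLinearMap L).compContinuousLinearMap L' = η.compContinuousLinearMap (L.comp L') := by
  ext v; rfl

omit [NormedSpace ℂ E] in
/-- Precomposition with the identity. [folklore] -/
theorem compContinuousLinearMap_id' [NormedSpace ℝ E] (η : E [⋀^Fin k]→L[ℝ] F) :
    η.compContinuousLinearMap (ContinuousLinearMap.id ℝ E) = η := by
  ext v; rfl

/-! ### Complex-linear precomposition (see `PQTypesPullbackProofs`) -/

/-- A continuous complex-linear map, with scalars restricted, is complex-linear. [folklore] -/
theorem restrictScalars_apply_smul (L : E' →L[ℂ] E) (c : ℂ) (v : E') :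
    (L.restrictScalars ℝ) (c • v) = c • (L.restrictScalars ℝ) v := by
  simp

/-- The real derivative of a map complex-differentiable at `x` is complex-linear. [folklore] -/
theorem fderiv_real_apply_smul {Φ : E' → E} {x : E'} (hΦ : DifferentiableAt ℂ Φ x) (c : ℂ) (v : E') :
    fderiv ℝ Φ x (c • v) = c • fderiv ℝ Φ x v := by
  rw [hΦ.fderiv_restrictScalars ℝ]
  simp

/-! ### The flat pull-back -/

/-- **Pull-back of a flat form along a map**: `(Φ^*α)(x) = α(Φ x) ∘ DΦ(x)` (Mathlib's pull-back
expression in `extDeriv_pullback`). [folklore] -/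
def flatPullback (Φ : E' → E) (α : E → E [⋀^Fin k]→L[ℝ] F) : E' → E' [⋀^Fin k]→L[ℝ] F :=
  fun x => (α (Φ x)).compContinuousLinearMap (fderiv ℝ Φ x)

/-- Unfolding of `flatPullback`. [folklore] -/
@[simp]
theorem flatPullback_apply (Φ : E' → E) (α : E → E [⋀^Fin k]→L[ℝ] F) (x : E') :
    flatPullback Φ α x = (α (Φ x)).compContinuousLinearMap (fderiv ℝ Φ x) :=
  rfl

/-- Pull-back along a continuous linear map. [folklore] -/
theorem flatPullback_clm (L : E' →L[ℝ] E) (α : E → E [⋀^Fin k]→L[ℝ] F) (x : E') :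
    flatPullback L α x = (α (L x)).compContinuousLinearMap L := by
  rw [flatPullback_apply, L.fderiv]

/-- Pull-back of the zero form. [folklore] -/
@[simp]
theorem flatPullback_zero (Φ : E' → E) : flatPullback Φ (0 : E → E [⋀^Fin k]→L[ℝ] F) = 0 := by
  funext x; ext v; rfl

/-- Pull-back of a difference. [folklore] -/
theorem flatPullback_sub (Φ : E' → E) (α α' : E → E [⋀^Fin k]→L[ℝ] F) :
    flatPullback Φ (fun y => α y - α' y) = fun x => flatPullback Φ α x - flatPullback Φ α' x := by
  funext x; ext v; rfl

/-- Pull-back of a scalar multiple: `Φ^*(φ α) = (φ ∘ Φ) Φ^*α`. [folklore] -/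
theorem flatPullback_smul (Φ : E' → E) (φ : E → ℂ) (α : E → E [⋀^Fin k]→L[ℝ] ℂ) :
    flatPullback Φ (fun y => φ y • α y) = fun x => φ (Φ x) • flatPullback Φ α x := by
  funext x; ext v; rfl

/-- The value of a pulled-back form vanishes where the form vanishes. [folklore] -/
theorem flatPullback_apply_eq_zero {Φ : E' → E} {α : E → E [⋀^Fin k]→L[ℝ] F} {x : E'}
    (h : α (Φ x) = 0) : flatPullback Φ α x = 0 := by
  rw [flatPullback_apply, h]; ext v; rfl

/-- **Functoriality**: `Ψ^*(Φ^*α) = (Φ ∘ Ψ)^*α` at points where the chain rule applies.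
[folklore] -/
theorem flatPullback_flatPullback {Φ : E' → E} {Ψ : E'' → E'} (α : E → E [⋀^Fin k]→L[ℝ] F) {x : E''}
    (hΨ : DifferentiableAt ℝ Ψ x) (hΦ : DifferentiableAt ℝ Φ (Ψ x)) :
    flatPullback Ψ (flatPullback Φ α) x = flatPullback (Φ ∘ Ψ) α x := by
  simp only [flatPullback_apply, compContinuousLinearMap_compContinuousLinearMap]
  rw [fderiv_comp x hΦ hΨ]
  rfl

/-- Pull-back along the identity. [folklore] -/
@[simp]
theorem flatPullback_id (α : E → E [⋀^Fin k]→L[ℝ] F) : flatPullback id α = α := by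
  funext x
  rw [flatPullback_apply, fderiv_id]
  exact compContinuousLinearMap_id' _

/-! ### Smoothness and `d` -/

/-- **The pull-back of a `C^∞` form along a `C^∞` map is `C^∞`** (on the preimage of the set
where the form is smooth). [folklore] -/
theorem ContDiffOn.flatPullback {α : E → E [⋀^Fin k]→L[ℝ] F} {s : Set E} (hα : ContDiffOn ℝ ∞ α s)
    (hs : IsOpen s) {Φ : E' → E} (hΦ : ContDiff ℝ ∞ Φ) :
    ContDiffOn ℝ ∞ (flatPullback Φ α) (Φ ⁻¹' s) := by
  intro x hx
  have h1 : ContDiffAt ℝ ∞ (fun y => α (Φ y)) x :=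
    (hα.contDiffAt (hs.mem_nhds hx)).comp x hΦ.contDiffAt
  have h2 : ContDiffAt ℝ ∞ (fderiv ℝ Φ) x := (hΦ.fderiv_right (m := ∞) le_rfl).contDiffAt
  exact (ContDiffAt.continuousAlternatingMapCompContinuousLinearMap h1 h2).contDiffWithinAt

/-- Pull-back of a globally `C^∞` form along a `C^∞` map is `C^∞`. [folklore] -/
theorem ContDiff.flatPullback {α : E → E [⋀^Fin k]→L[ℝ] F} (hα : ContDiff ℝ ∞ α) {Φ : E' → E}
    (hΦ : ContDiff ℝ ∞ Φ) : ContDiff ℝ ∞ (flatPullback Φ α) := by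
  rw [← contDiffOn_univ] at hα ⊢
  exact ContDiffOn.flatPullback hα isOpen_univ hΦ

/-- **`d` commutes with pull-back** (Mathlib's `extDeriv_pullback`):
`d(Φ^*α)(x) = (dα)(Φ x) ∘ DΦ(x)`. [folklore] -/
theorem extDeriv_flatPullback {α : E → E [⋀^Fin k]→L[ℝ] F} {Φ : E' → E} {x : E'}
    (hα : DifferentiableAt ℝ α (Φ x)) (hΦ : ContDiffAt ℝ ∞ Φ x) :
    extDeriv (flatPullback Φ α) x = (extDeriv α (Φ x)).compContinuousLinearMap (fderiv ℝ Φ x) :=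
  extDeriv_pullback (r := ∞) hα hΦ
    (by rw [minSmoothness_of_isRCLikeNormedField]; exact WithTop.coe_le_coe.2 le_top)

/-! ### Holomorphic maps -/

/-- An entire map between finite-dimensional complex spaces is real-`C^∞`. [folklore] -/
theorem contDiff_real_of_differentiable [FiniteDimensional ℂ E'] [CompleteSpace E] {Φ : E' → E}
    (hΦ : Differentiable ℂ Φ) : ContDiff ℝ ∞ Φ := by
  have h := SCV.contDiffOn_infty hΦ.differentiableOn isOpen_univ
  exact (contDiffOn_univ.1 h).restrict_scalars ℝ

/-- A map complex-differentiable on an open set of a finite-dimensional space is real-`C^∞`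
there. [folklore] -/
theorem contDiffOn_real_of_differentiableOn [FiniteDimensional ℂ E'] [CompleteSpace E] {Φ : E' → E}
    {s : Set E'} (hΦ : DifferentiableOn ℂ Φ s) (hs : IsOpen s) : ContDiffOn ℝ ∞ Φ s :=
  (SCV.contDiffOn_infty hΦ hs).restrict_scalars ℝ

/-- Along a map complex-differentiable at `x`, pull-back preserves pointwise types.
[cite: Voisin2002, §2.3.1] -/
theorem IsOfTypeAt.flatPullback {p q : ℕ} {Φ : E' → E} {α : E → E [⋀^Fin k]→L[ℝ] ℂ} {x : E'}
    (hα : IsOfTypeAt p q (α (Φ x))) (hΦ : DifferentiableAt ℂ Φ x) :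
    IsOfTypeAt p q (flatPullback Φ α x) :=
  hα.compContinuousLinearMap _ (fderiv_real_apply_smul hΦ)

/-- Along a map complex-differentiable at `x`, pull-back commutes with the type projection.
[cite: Voisin2002, §2.3.1 eq. (2.4)] -/
theorem typeProjAt_flatPullback (p q : ℕ) {Φ : E' → E} (α : E → E [⋀^Fin k]→L[ℝ] ℂ) {x : E'}
    (hΦ : DifferentiableAt ℂ Φ x) :
    typeProjAt p q (flatPullback Φ α x) =
      (typeProjAt p q (α (Φ x))).compContinuousLinearMap (fderiv ℝ Φ x) :=
  typeProjAt_compContinuousLinearMap p q _ _ (fderiv_real_apply_smul hΦ)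

/-- A pull-back along a holomorphic map of a form fixed by the `(p,q)`-projection is fixed by it.
[cite: Voisin2002, §2.3.1] -/
theorem typeProjAt_flatPullback_eq_self {p q : ℕ} {Φ : E' → E} {α : E → E [⋀^Fin k]→L[ℝ] ℂ} {x : E'}
    (hα : typeProjAt p q (α (Φ x)) = α (Φ x)) (hΦ : DifferentiableAt ℂ Φ x) :
    typeProjAt p q (flatPullback Φ α x) = flatPullback Φ α x := by
  rw [typeProjAt_flatPullback p q α hΦ, hα, flatPullback_apply]

/-- **`∂̄` commutes with holomorphic pull-backs, flat form**: along a map `Φ` that is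
complex-differentiable at `x` and real-`C^∞` near `x`,
`(d Φ^*α)^{p,q}(x) = (dα)^{p,q}(Φ x) ∘ DΦ(x)` (Hörmander (1973), §2.1: `∂̄` is invariant under
analytic maps). [cite: HormanderSCV1973, §2.1] -/
theorem typeProjAt_extDeriv_flatPullback (p q : ℕ) {Φ : E' → E} {α : E → E [⋀^Fin k]→L[ℝ] ℂ} {x : E'}
    (hα : DifferentiableAt ℝ α (Φ x)) (hΦ : ContDiffAt ℝ ∞ Φ x) (hΦc : DifferentiableAt ℂ Φ x) :
    typeProjAt p q (extDeriv (flatPullback Φ α) x) =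
      (typeProjAt p q (extDeriv α (Φ x))).compContinuousLinearMap (fderiv ℝ Φ x) := by
  rw [extDeriv_flatPullback hα hΦ, typeProjAt_compContinuousLinearMap p q _ _ (fderiv_real_apply_smul hΦc)]

/-! ### Holomorphic scalar factors: `∂̄(φ α) = φ ∂̄α` -/

section Factor

variable {ι : Type*} [Fintype ι] [DecidableEq ι]

/-- **`∂̄(φ α) = φ ∂̄α` for a holomorphic factor**: if `φ : ℂ^ι → ℂ` is complex-differentiable at
`x` and `α : ℂ^ι → Λ^k` (values of type `(p,q)`) is real-differentiable at `x`, then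
`(d(φ α))^{p,q+1}(x) = φ(x) (dα)^{p,q+1}(x)` (coordinates: `∂̄_j (φ α) = (∂̄_j φ) α + φ ∂̄_j α` and
`∂̄_j φ = 0`). [cite: HormanderSCV1973, §2.1] -/
theorem typeProjAt_extDeriv_smul_of_differentiableAt {p q : ℕ} {φ : (ι → ℂ) → ℂ}
    {α : (ι → ℂ) → (ι → ℂ) [⋀^Fin k]→L[ℝ] ℂ} (hα : ∀ y, IsOfTypeAt p q (α y)) {x : ι → ℂ}
    (hφ : DifferentiableAt ℂ φ x) (hαd : DifferentiableAt ℝ α x) :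
    typeProjAt p (q + 1) (extDeriv (fun y => φ y • α y) x) =
      φ x • typeProjAt p (q + 1) (extDeriv α x) := by
  have ht : ∀ y, IsOfTypeAt p q (φ y • α y) := fun y => (hα y).smul _
  rw [typeProjAt_extDeriv_eq_sum ht, typeProjAt_extDeriv_eq_sum hα, Finset.smul_sum]
  refine Finset.sum_congr rfl fun j _ => ?_
  rw [dbarAlong_smul (hφ.restrictScalars ℝ) hαd, dbarAlong_eq_zero_of_differentiableAt hφ,
    zero_smul, zero_add, wedgeOne_smul]

/-- **`∂̄(φ α) = 0` where `α` is `∂̄`-closed and `φ` holomorphic.** [cite: HormanderSCV1973, §2.1] -/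
theorem typeProjAt_extDeriv_smul_eq_zero {p q : ℕ} {φ : (ι → ℂ) → ℂ}
    {α : (ι → ℂ) → (ι → ℂ) [⋀^Fin k]→L[ℝ] ℂ} (hα : ∀ y, IsOfTypeAt p q (α y)) {x : ι → ℂ}
    (hφ : DifferentiableAt ℂ φ x) (hαd : DifferentiableAt ℝ α x)
    (hc : typeProjAt p (q + 1) (extDeriv α x) = 0) :
    typeProjAt p (q + 1) (extDeriv (fun y => φ y • α y) x) = 0 := by
  rw [typeProjAt_extDeriv_smul_of_differentiableAt hα hφ hαd, hc]
  ext v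
  simp

end Factor

end Literature.Analysis.Complex
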